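import Summits.NavierStokesRegularity.NavierStokesRegularity.Theorems.MustSqueeze.Negative.LinearLerayProfiles
import Mathlib.Analysis.SpecialFunctions.SmoothTransition

/-!
# Crux `MustSqueeze`, negative side — Targets: the line's quantitative stubs are false without the class

Negative-side support for crux `MustSqueeze` (stmt-NavierStokesRegularity-11610), cdisprove gen 4
(`Cruxes/MustSqueeze/Disproof.lean` §12), on the LEVER of the picked line outward-drift-signed-flux
(lead skeleton v1, sha 75fd2eb7, `stub_signedBudget`):
`Targets.SignedBudgetWithoutClass` is that stub with its two CLASS hypotheses deleted —
`IsTypeIAncientMild C u` and the similarity bound `‖U‖ ≤ C` — and everything else kept verbatim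
(the squeeze `Λ ≤ a`, `0 ≤ a`, continuity of the ball gradient energies, the div–curl comparison
with constant `κ'`, and the conclusion: differentiability of `Z_R`, a continuous forcing
`0 ≤ K ≤ κ(E(2R)/R + √(E(2R)/R))` and `Z_R' ≤ −2(¼ − a)Z_R + K`).

`Targets.signedBudget_false_without_class`: it is FALSE.  Witness: the stretched similarity column
`u = lin ½ 1` of `Negative.LinearLerayProfiles` (an exact ancient Navier–Stokes flow, Leray profile
`linA ½ 1`), with `a = 0`, `κ' = 0`.  Its similarity orbit is the steady profile, its similarity
vorticity the constant `−2e₂`, so `Z_R(s) = 4∫φ_R` is constant in `s` with `∫φ_R ≥ R³|B₁|`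
(`integral_cutoff_ge`), while `E(ρ, s) = (7/2)ρ³|B₁|` (`ballGradEnergy_col`); the squeeze holds with
`a = 0` (`Λ ≡ −½`), the comparison holds with `κ' = 0` (`7/2 ≤ 4` pointwise), yet the budget would
force `2R³|B₁| ≤ |κ|(56|B₁| + 1)R²` for all `R ≥ 1`.  So any proof of the lever must use the class:
concretely the bound `‖U‖_∞ ≤ C` in the constants of the transport flux `½∫|Ω|²(U·∇φ_R)` and of the
cubic flux — for the column both are of order `R³`, not `E(2R)/R ∼ R²`.

`Targets.divCurlBalls_false_without_class`: likewise `stub_divCurlBalls` with `IsTypeIAncientMild` and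
the Morrey slice bound deleted is FALSE (witness the irrotational pure strain `lin 1 0`: `Z_R ≡ 0`,
`∫φ_R|∇U|²_F = 6∫φ_R ≥ 6R³|B₁|`, `E(2R) = 48R³|B₁|`): the comparison spends H5a.  Closes nothing.
-/

noncomputable section

namespace Summit.NavierStokesRegularity.NavierStokesRegularity.Theorems.MustSqueeze.Negative

open MeasureTheory Set Filter Topology
open Literature.Analysis.FluidPDE
open scoped RealInnerProductSpace

/-- Physical / similarity space `ℝ³`. -/
local notation "ℝ³" => EuclideanSpace ℝ (Fin 3)

namespace Targets

/-! ### The cutoff `φ_R(y) = smoothTransition (2 − ‖y‖²/R²)` of the skeleton -/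

/-- `0 ≤ φ_R`. -/
theorem cutoff_nonneg (R : ℝ) (y : ℝ³) : 0 ≤ Real.smoothTransition (2 - ‖y‖ ^ 2 / R ^ 2) :=
  Real.smoothTransition.nonneg _

/-- `φ_R = 1` on the ball `B_R`. -/
theorem cutoff_eq_one {R : ℝ} (hR : 0 < R) {y : ℝ³} (hy : y ∈ Metric.ball (0 : ℝ³) R) :
    Real.smoothTransition (2 - ‖y‖ ^ 2 / R ^ 2) = 1 := by
  refine Real.smoothTransition.one_of_one_le ?_
  rw [Metric.mem_ball, dist_zero_right] at hy
  have h1 : ‖y‖ ^ 2 < R ^ 2 := by nlinarith [norm_nonneg y]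
  have h2 : ‖y‖ ^ 2 / R ^ 2 < 1 := (div_lt_one (by positivity)).2 h1
  linarith

/-- `φ_R = 0` outside the ball `B_{2R}`. -/
theorem cutoff_eq_zero {R : ℝ} (hR : 0 < R) {y : ℝ³} (hy : 2 * R ≤ ‖y‖) :
    Real.smoothTransition (2 - ‖y‖ ^ 2 / R ^ 2) = 0 := by
  refine Real.smoothTransition.zero_of_nonpos ?_
  have h1 : 4 * R ^ 2 ≤ ‖y‖ ^ 2 := by nlinarith
  have h2 : 2 ≤ ‖y‖ ^ 2 / R ^ 2 := by
    rw [le_div_iff₀ (by positivity)]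
    nlinarith [sq_nonneg R]
  linarith

/-- `φ_R` is continuous. -/
theorem continuous_cutoff (R : ℝ) : Continuous fun y : ℝ³ => Real.smoothTransition (2 - ‖y‖ ^ 2 / R ^ 2) :=
  Real.smoothTransition.continuous.comp (continuous_const.sub ((continuous_norm.pow 2).div_const _))

/-- `φ_R` has compact support (inside the closed ball of radius `2R`). -/
theorem hasCompactSupport_cutoff {R : ℝ} (hR : 0 < R) :
    HasCompactSupport fun y : ℝ³ => Real.smoothTransition (2 - ‖y‖ ^ 2 / R ^ 2) := by
  refine HasCompactSupport.of_support_subset_isCompact (isCompact_closedBall (0 : ℝ³) (2 * R)) ?_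
  intro y hy
  rw [Metric.mem_closedBall, dist_zero_right]
  by_contra h
  exact hy (cutoff_eq_zero hR (not_le.1 h).le)

/-- `φ_R` is integrable. -/
theorem integrable_cutoff {R : ℝ} (hR : 0 < R) :
    Integrable fun y : ℝ³ => Real.smoothTransition (2 - ‖y‖ ^ 2 / R ^ 2) :=
  (continuous_cutoff R).integrable_of_hasCompactSupport (hasCompactSupport_cutoff hR)

/-- `∫φ_R ≥ R³|B₁|`. -/
theorem integral_cutoff_ge {R : ℝ} (hR : 0 < R) :
    R ^ 3 * V1 ≤ ∫ y : ℝ³, Real.smoothTransition (2 - ‖y‖ ^ 2 / R ^ 2) := by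
  calc R ^ 3 * V1 = ∫ _ in Metric.ball (0 : ℝ³) R, (1 : ℝ) := by
        rw [setIntegral_const, smul_eq_mul, mul_one, measureReal_def, volume_ball_toReal 0 hR]
    _ = ∫ y in Metric.ball (0 : ℝ³) R, Real.smoothTransition (2 - ‖y‖ ^ 2 / R ^ 2) :=
        setIntegral_congr_fun measurableSet_ball fun y hy => (cutoff_eq_one hR hy).symm
    _ ≤ ∫ y : ℝ³, Real.smoothTransition (2 - ‖y‖ ^ 2 / R ^ 2) :=
        setIntegral_le_integral (integrable_cutoff hR) (Eventually.of_forall (cutoff_nonneg R))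

/-! ### The column `u = lin ½ 1` read through the skeleton's functionals -/

/-- The similarity orbit of the column is the steady profile. -/
theorem lerayOrbit_col (s : ℝ) : lerayOrbit (lin (1 / 2) 1) s = ⇑(linA (1 / 2) 1) :=
  funext (lerayOrbit_lin _ _ s)

/-- `|Ω|² ≡ 4` for the column. -/
theorem norm_lerayVorticity_col_sq (s : ℝ) (y : ℝ³) : ‖lerayVorticity (lin (1 / 2) 1) s y‖ ^ 2 = 4 := by
  rw [lerayVorticity_lin, norm_smul, norm_e2, mul_one, Real.norm_eq_abs]
  norm_num

/-- The localised similarity enstrophy of the column: `Z_R(s) = 4∫φ_R`, constant in `s`. -/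
theorem cutoffEnstrophy_col (R s : ℝ) :
    (∫ y : ℝ³, Real.smoothTransition (2 - ‖y‖ ^ 2 / R ^ 2) * ‖lerayVorticity (lin (1 / 2) 1) s y‖ ^ 2) =
      4 * ∫ y : ℝ³, Real.smoothTransition (2 - ‖y‖ ^ 2 / R ^ 2) := by
  simp_rw [norm_lerayVorticity_col_sq]
  rw [integral_mul_const]
  ring

/-- `‖linA μ b y‖²` in coordinates. -/
theorem norm_linA_sq (μ b : ℝ) (y : ℝ³) :
    ‖linA μ b y‖ ^ 2 = (-μ * y 0 + b * y 1) ^ 2 + (-b * y 0 - μ * y 1) ^ 2 + (2 * μ * y 2) ^ 2 := by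
  rw [EuclideanSpace.real_norm_sq_eq, Fin.sum_univ_three, linA_fst, linA_snd, linA_thd]

/-- The Frobenius norm of the column gradient: `|∇U|²_F = ¼ + 1 + 1 + ¼ + 1 = 7/2`. -/
theorem frobeniusNormSq_col : frobeniusNormSq (linA (1 / 2) 1 : ℝ³ →L[ℝ] ℝ³) = 7 / 2 := by
  rw [frobeniusNormSq_eq_sum (EuclideanSpace.basisFun (Fin 3) ℝ), Fin.sum_univ_three]
  simp [EuclideanSpace.basisFun_apply, norm_linA_sq]
  norm_num

/-- The ball gradient energies of the column: `E(ρ, s) = (7/2)ρ³|B₁|`. -/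
theorem ballGradEnergy_col {ρ : ℝ} (hρ : 0 < ρ) (s : ℝ) :
    (∫ y in Metric.ball (0 : ℝ³) ρ, frobeniusNormSq (fderiv ℝ (lerayOrbit (lin (1 / 2) 1) s) y)) =
      7 / 2 * (ρ ^ 3 * V1) := by
  rw [lerayOrbit_col]
  simp_rw [ContinuousLinearMap.fderiv, frobeniusNormSq_col]
  rw [setIntegral_const, smul_eq_mul, measureReal_def, volume_ball_toReal 0 hρ]
  ring

/-- The cutoff gradient energy of the column: `∫φ_R|∇U|²_F = (7/2)∫φ_R`. -/
theorem cutoffGradEnergy_col (R s : ℝ) :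
    (∫ y : ℝ³, Real.smoothTransition (2 - ‖y‖ ^ 2 / R ^ 2) *
        frobeniusNormSq (fderiv ℝ (lerayOrbit (lin (1 / 2) 1) s) y)) =
      7 / 2 * ∫ y : ℝ³, Real.smoothTransition (2 - ‖y‖ ^ 2 / R ^ 2) := by
  rw [lerayOrbit_col]
  simp_rw [ContinuousLinearMap.fderiv, frobeniusNormSq_col]
  rw [integral_mul_const]
  ring

/-- The column is squeezed in the Leray gauge with threshold `0`: `Λ ≤ 0` everywhere. -/
theorem lerayMiddleStrain_col_le (t : ℝ) (ht : t < 0) (x : ℝ³) :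
    lerayMiddleStrain (lin (1 / 2) 1) t x ≤ 0 :=
  (lerayMiddleStrain_le_iff ht 0).2 (lin_h6 (1 / 2) 1 (by norm_num : -(1 / 2 : ℝ) ≤ 0) t ht x)

/-! ### The stub without its class hypotheses, and its failure -/

/-- `stub_signedBudget` (lead skeleton v1 of line outward-drift-signed-flux) with the CLASS
hypotheses `IsTypeIAncientMild C u` and `∀ s y, ‖lerayOrbit u s y‖ ≤ C` DELETED; the squeeze,
`0 ≤ a`, the continuity of the ball gradient energies, the div–curl comparison and the conclusion
are verbatim. -/
def SignedBudgetWithoutClass : Prop :=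
  ∀ (a κ' : ℝ) (u : ℝ → ℝ³ → ℝ³),
    (∀ t < 0, ∀ x, lerayMiddleStrain u t x ≤ a) → 0 ≤ a →
    (∀ ρ : ℝ, 0 < ρ →
      Continuous fun s => ∫ y in Metric.ball (0 : ℝ³) ρ, frobeniusNormSq (fderiv ℝ (lerayOrbit u s) y)) →
    (∀ (R s : ℝ), 1 ≤ R →
      (∫ y, Real.smoothTransition (2 - ‖y‖ ^ 2 / R ^ 2) * frobeniusNormSq (fderiv ℝ (lerayOrbit u s) y)) ≤
        (∫ y, Real.smoothTransition (2 - ‖y‖ ^ 2 / R ^ 2) * ‖lerayVorticity u s y‖ ^ 2) +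
          κ' * Real.sqrt ((∫ y in Metric.ball (0 : ℝ³) (2 * R),
            frobeniusNormSq (fderiv ℝ (lerayOrbit u s) y)) / R)) →
    ∃ κ : ℝ, ∀ R : ℝ, 1 ≤ R →
      Differentiable ℝ (fun s => ∫ y, Real.smoothTransition (2 - ‖y‖ ^ 2 / R ^ 2) * ‖lerayVorticity u s y‖ ^ 2) ∧
      ∃ K : ℝ → ℝ, Continuous K ∧ (∀ s, 0 ≤ K s) ∧
        (∀ s, K s ≤ κ * ((∫ y in Metric.ball (0 : ℝ³) (2 * R), frobeniusNormSq (fderiv ℝ (lerayOrbit u s) y)) / R +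
          Real.sqrt ((∫ y in Metric.ball (0 : ℝ³) (2 * R), frobeniusNormSq (fderiv ℝ (lerayOrbit u s) y)) / R))) ∧
        ∀ s, deriv (fun s => ∫ y, Real.smoothTransition (2 - ‖y‖ ^ 2 / R ^ 2) * ‖lerayVorticity u s y‖ ^ 2) s ≤
          -(2 * (1 / 4 - a)) * (∫ y, Real.smoothTransition (2 - ‖y‖ ^ 2 / R ^ 2) * ‖lerayVorticity u s y‖ ^ 2) + K s

/-- `√x ≤ x + 1` for `x ≥ 0`. -/
theorem sqrt_le_add_one {x : ℝ} (hx : 0 ≤ x) : Real.sqrt x ≤ x + 1 := by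
  nlinarith [Real.sq_sqrt hx, Real.sqrt_nonneg x, sq_nonneg (Real.sqrt x - 1)]

/-- **The lever is false without its class hypotheses.**  Witness: the stretched similarity
column `u = lin ½ 1` (exact ancient Navier–Stokes, `Negative.LinearLerayProfiles`), `a = 0`,
`κ' = 0`: every remaining hypothesis holds (`Λ ≡ −½ ≤ 0`; `E(ρ, ·)` constant; comparison
`(7/2)∫φ_R ≤ 4∫φ_R`), but `Z_R ≡ 4∫φ_R ≥ 4R³|B₁|` is constant in `s`, so the budget at `s = 0`
would give `2R³|B₁| ≤ K(0) ≤ |κ|(56|B₁| + 1)R²` for every `R ≥ 1` — false at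
`R = |κ|(56|B₁| + 1)/(2|B₁|) + 1`.  Hence `stub_signedBudget` genuinely spends
`IsTypeIAncientMild` / `‖U‖ ≤ C` (in the flux constants), as the Disproof's §11 explains. -/
theorem signedBudget_false_without_class : ¬ SignedBudgetWithoutClass := by
  intro h
  have hV : 0 < V1 :=
    ENNReal.toReal_pos (Metric.measure_ball_pos volume (0 : ℝ³) one_pos).ne' measure_ball_lt_top.ne
  -- the remaining hypotheses hold for the column with `a = 0`, `κ' = 0`
  have hcont : ∀ ρ : ℝ, 0 < ρ → Continuous fun s =>
      ∫ y in Metric.ball (0 : ℝ³) ρ, frobeniusNormSq (fderiv ℝ (lerayOrbit (lin (1 / 2) 1) s) y) := by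
    intro ρ hρ
    have : (fun s => ∫ y in Metric.ball (0 : ℝ³) ρ,
        frobeniusNormSq (fderiv ℝ (lerayOrbit (lin (1 / 2) 1) s) y)) = fun _ => 7 / 2 * (ρ ^ 3 * V1) :=
      funext fun s => ballGradEnergy_col hρ s
    rw [this]
    exact continuous_const
  have hcomp : ∀ (R s : ℝ), 1 ≤ R →
      (∫ y, Real.smoothTransition (2 - ‖y‖ ^ 2 / R ^ 2) *
          frobeniusNormSq (fderiv ℝ (lerayOrbit (lin (1 / 2) 1) s) y)) ≤
        (∫ y, Real.smoothTransition (2 - ‖y‖ ^ 2 / R ^ 2) * ‖lerayVorticity (lin (1 / 2) 1) s y‖ ^ 2) +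
          0 * Real.sqrt ((∫ y in Metric.ball (0 : ℝ³) (2 * R),
            frobeniusNormSq (fderiv ℝ (lerayOrbit (lin (1 / 2) 1) s) y)) / R) := by
    intro R s _
    rw [cutoffGradEnergy_col, cutoffEnstrophy_col, zero_mul, add_zero]
    have hI : 0 ≤ ∫ y : ℝ³, Real.smoothTransition (2 - ‖y‖ ^ 2 / R ^ 2) :=
      integral_nonneg (cutoff_nonneg R)
    nlinarith
  obtain ⟨κ, hκ⟩ := h 0 0 (lin (1 / 2) 1) lerayMiddleStrain_col_le le_rfl hcont hcomp
  -- evaluate the budget at a large radius and `s = 0`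
  set R : ℝ := |κ| * (56 * V1 + 1) / (2 * V1) + 1 with hR
  have hR1 : 1 ≤ R := by
    have : 0 ≤ |κ| * (56 * V1 + 1) / (2 * V1) := by positivity
    linarith
  have hR0 : 0 < R := by linarith
  obtain ⟨-, K, -, hK0, hKle, hderiv⟩ := hκ R hR1
  have hZ : (fun s => ∫ y : ℝ³, Real.smoothTransition (2 - ‖y‖ ^ 2 / R ^ 2) *
      ‖lerayVorticity (lin (1 / 2) 1) s y‖ ^ 2) =
      fun _ => 4 * ∫ y : ℝ³, Real.smoothTransition (2 - ‖y‖ ^ 2 / R ^ 2) :=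
    funext (cutoffEnstrophy_col R)
  have hd := hderiv 0
  rw [hZ, deriv_const, cutoffEnstrophy_col] at hd
  have hE : (∫ y in Metric.ball (0 : ℝ³) (2 * R),
      frobeniusNormSq (fderiv ℝ (lerayOrbit (lin (1 / 2) 1) 0) y)) = 28 * R ^ 3 * V1 := by
    rw [ballGradEnergy_col (by linarith) 0]
    ring
  have hK := hKle 0
  rw [hE] at hK
  -- sizes
  set I : ℝ := ∫ y : ℝ³, Real.smoothTransition (2 - ‖y‖ ^ 2 / R ^ 2) with hI
  have hIge : R ^ 3 * V1 ≤ I := integral_cutoff_ge hR0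
  have hx : 28 * R ^ 3 * V1 / R = 28 * R ^ 2 * V1 := by
    field_simp
  rw [hx] at hK
  have hx0 : 0 ≤ 28 * R ^ 2 * V1 := by positivity
  have hsq : Real.sqrt (28 * R ^ 2 * V1) ≤ 28 * R ^ 2 * V1 + 1 := sqrt_le_add_one hx0
  have hK' : K 0 ≤ |κ| * (56 * R ^ 2 * V1 + 1) := by
    calc K 0 ≤ κ * (28 * R ^ 2 * V1 + Real.sqrt (28 * R ^ 2 * V1)) := hK
      _ ≤ |κ| * (28 * R ^ 2 * V1 + Real.sqrt (28 * R ^ 2 * V1)) :=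
          mul_le_mul_of_nonneg_right (le_abs_self κ) (by positivity)
      _ ≤ |κ| * (56 * R ^ 2 * V1 + 1) := by
          refine mul_le_mul_of_nonneg_left ?_ (abs_nonneg κ)
          linarith
  -- the budget at `s = 0`: `0 ≤ −½ · 4I + K 0`, i.e. `2I ≤ K 0`
  have hbud : 2 * I ≤ K 0 := by
    have := hd
    norm_num at this
    linarith
  -- so `2 R³ V1 ≤ |κ|(56 R² V1 + 1) ≤ |κ|(56 V1 + 1) R²`, i.e. `2 R V1 ≤ |κ|(56 V1 + 1)`
  have h1 : 2 * (R ^ 3 * V1) ≤ |κ| * (56 * V1 + 1) * R ^ 2 := by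
    have hR2 : 1 ≤ R ^ 2 := by nlinarith
    have : |κ| * (56 * R ^ 2 * V1 + 1) ≤ |κ| * (56 * V1 + 1) * R ^ 2 := by
      have hk : 0 ≤ |κ| := abs_nonneg κ
      nlinarith [mul_nonneg hk (by linarith : (0 : ℝ) ≤ R ^ 2 - 1)]
    linarith
  have h2 : 2 * R * V1 ≤ |κ| * (56 * V1 + 1) := by
    have hR2 : 0 < R ^ 2 := by positivity
    have : 2 * R * V1 * R ^ 2 ≤ |κ| * (56 * V1 + 1) * R ^ 2 := by nlinarith
    exact le_of_mul_le_mul_right this hR2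
  -- contradiction with the choice of `R`
  have h3 : |κ| * (56 * V1 + 1) < 2 * R * V1 := by
    have : 2 * R * V1 = |κ| * (56 * V1 + 1) + 2 * V1 := by
      rw [hR]
      field_simp
    rw [this]
    linarith
  linarith

/-! ### The div–curl comparison stub without its class hypotheses -/

/-- `|Ω|² ≡ 0` for the pure strain `u = lin 1 0` (irrotational). -/
theorem lerayVorticity_strain (s : ℝ) (y : ℝ³) : lerayVorticity (lin 1 0) s y = 0 := by
  rw [lerayVorticity_lin]
  simp

/-- The similarity orbit of the pure strain is the steady profile. -/
theorem lerayOrbit_strain (s : ℝ) : lerayOrbit (lin 1 0) s = ⇑(linA 1 0) :=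
  funext (lerayOrbit_lin _ _ s)

/-- The Frobenius norm of the pure-strain gradient `diag(−1, −1, 2)`: `6`. -/
theorem frobeniusNormSq_strain : frobeniusNormSq (linA 1 0 : ℝ³ →L[ℝ] ℝ³) = 6 := by
  rw [frobeniusNormSq_eq_sum (EuclideanSpace.basisFun (Fin 3) ℝ), Fin.sum_univ_three]
  simp [EuclideanSpace.basisFun_apply, norm_linA_sq]
  norm_num

/-- The ball gradient energies of the pure strain: `E(ρ, s) = 6ρ³|B₁|`. -/
theorem ballGradEnergy_strain {ρ : ℝ} (hρ : 0 < ρ) (s : ℝ) :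
    (∫ y in Metric.ball (0 : ℝ³) ρ, frobeniusNormSq (fderiv ℝ (lerayOrbit (lin 1 0) s) y)) =
      6 * (ρ ^ 3 * V1) := by
  rw [lerayOrbit_strain]
  simp_rw [ContinuousLinearMap.fderiv, frobeniusNormSq_strain]
  rw [setIntegral_const, smul_eq_mul, measureReal_def, volume_ball_toReal 0 hρ]
  ring

/-- The cutoff gradient energy of the pure strain: `∫φ_R|∇U|²_F = 6∫φ_R`. -/
theorem cutoffGradEnergy_strain (R s : ℝ) :
    (∫ y : ℝ³, Real.smoothTransition (2 - ‖y‖ ^ 2 / R ^ 2) *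
        frobeniusNormSq (fderiv ℝ (lerayOrbit (lin 1 0) s) y)) =
      6 * ∫ y : ℝ³, Real.smoothTransition (2 - ‖y‖ ^ 2 / R ^ 2) := by
  rw [lerayOrbit_strain]
  simp_rw [ContinuousLinearMap.fderiv, frobeniusNormSq_strain]
  rw [integral_mul_const]
  ring

/-- `stub_divCurlBalls` (lead skeleton v1) with the CLASS hypotheses `IsTypeIAncientMild C u` and the
Morrey slice bound `∫_{B_ρ(y₀)}|U(s)|² ≤ Cρ` DELETED; the four conclusions verbatim. -/
def DivCurlBallsWithoutClass : Prop :=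
  ∀ (u : ℝ → ℝ³ → ℝ³), ∃ κ' : ℝ, ∀ (R s : ℝ), 1 ≤ R →
      (∫ y, Real.smoothTransition (2 - ‖y‖ ^ 2 / R ^ 2) * ‖lerayVorticity u s y‖ ^ 2) ≤
          6 * ∫ y in Metric.ball (0 : ℝ³) (2 * R), frobeniusNormSq (fderiv ℝ (lerayOrbit u s) y) ∧
      (∫ y, Real.smoothTransition (2 - ‖y‖ ^ 2 / R ^ 2) * frobeniusNormSq (fderiv ℝ (lerayOrbit u s) y)) ≤
          (∫ y, Real.smoothTransition (2 - ‖y‖ ^ 2 / R ^ 2) * ‖lerayVorticity u s y‖ ^ 2) +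
            κ' * Real.sqrt ((∫ y in Metric.ball (0 : ℝ³) (2 * R),
              frobeniusNormSq (fderiv ℝ (lerayOrbit u s) y)) / R) ∧
      (∫ y in Metric.ball (0 : ℝ³) R, frobeniusNormSq (fderiv ℝ (lerayOrbit u s) y)) ≤
          (∫ y, Real.smoothTransition (2 - ‖y‖ ^ 2 / R ^ 2) * frobeniusNormSq (fderiv ℝ (lerayOrbit u s) y)) ∧
      (∀ R' : ℝ, R ≤ R' →
        (∫ y, Real.smoothTransition (2 - ‖y‖ ^ 2 / R ^ 2) * ‖lerayVorticity u s y‖ ^ 2) ≤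
          (∫ y, Real.smoothTransition (2 - ‖y‖ ^ 2 / R' ^ 2) * ‖lerayVorticity u s y‖ ^ 2))

/-- **The div–curl comparison is false without the class** (it spends the Morrey bound, i.e. H5a,
through the flux `∫φ tr(∇U²) = −∫∇φ·((U·∇)U)`).  Witness: the irrotational pure strain
`u = lin 1 0` (`U = diag(−1,−1,2)y`, an exact Leray profile, smooth, divergence free, squeezed
with `Λ ≡ −1`): `Z_R ≡ 0` while `∫φ_R|∇U|²_F = 6∫φ_R ≥ 6R³|B₁|` and `E(2R) = 48R³|B₁|`, so the
second conclusion would force `6R³|B₁| ≤ |κ'|(48|B₁| + 1)R²` for all `R ≥ 1`. -/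
theorem divCurlBalls_false_without_class : ¬ DivCurlBallsWithoutClass := by
  intro h
  have hV : 0 < V1 :=
    ENNReal.toReal_pos (Metric.measure_ball_pos volume (0 : ℝ³) one_pos).ne' measure_ball_lt_top.ne
  obtain ⟨κ', hκ⟩ := h (lin 1 0)
  set R : ℝ := |κ'| * (48 * V1 + 1) / (6 * V1) + 1 with hR
  have hR1 : 1 ≤ R := by
    have : 0 ≤ |κ'| * (48 * V1 + 1) / (6 * V1) := by positivity
    linarith
  have hR0 : 0 < R := by linarith
  obtain ⟨-, h2, -, -⟩ := hκ R 0 hR1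
  rw [cutoffGradEnergy_strain, ballGradEnergy_strain (by linarith) 0] at h2
  simp_rw [lerayVorticity_strain, norm_zero] at h2
  norm_num at h2
  -- h2 : 6 * ∫φ_R ≤ κ' * √(6 * ((2R)³ V1) / R)
  set I : ℝ := ∫ y : ℝ³, Real.smoothTransition (2 - ‖y‖ ^ 2 / R ^ 2) with hI
  have hIge : R ^ 3 * V1 ≤ I := integral_cutoff_ge hR0
  have hx : (6 : ℝ) * ((2 * R) ^ 3 * V1) / R = 48 * R ^ 2 * V1 := by
    field_simp
    ring
  rw [hx] at h2
  have hx0 : 0 ≤ 48 * R ^ 2 * V1 := by positivity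
  have hsq : Real.sqrt (48 * R ^ 2 * V1) ≤ 48 * R ^ 2 * V1 + 1 := sqrt_le_add_one hx0
  have h3 : 6 * I ≤ |κ'| * (48 * R ^ 2 * V1 + 1) := by
    calc 6 * I ≤ κ' * Real.sqrt (48 * R ^ 2 * V1) := h2
      _ ≤ |κ'| * Real.sqrt (48 * R ^ 2 * V1) :=
          mul_le_mul_of_nonneg_right (le_abs_self κ') (Real.sqrt_nonneg _)
      _ ≤ |κ'| * (48 * R ^ 2 * V1 + 1) := mul_le_mul_of_nonneg_left hsq (abs_nonneg κ')
  have h4 : 6 * (R ^ 3 * V1) ≤ |κ'| * (48 * V1 + 1) * R ^ 2 := by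
    have hk : 0 ≤ |κ'| := abs_nonneg κ'
    have : |κ'| * (48 * R ^ 2 * V1 + 1) ≤ |κ'| * (48 * V1 + 1) * R ^ 2 := by
      nlinarith [mul_nonneg hk (by nlinarith : (0 : ℝ) ≤ R ^ 2 - 1)]
    linarith
  have h5 : 6 * R * V1 ≤ |κ'| * (48 * V1 + 1) := by
    have hR2 : 0 < R ^ 2 := by positivity
    have : 6 * R * V1 * R ^ 2 ≤ |κ'| * (48 * V1 + 1) * R ^ 2 := by nlinarith
    exact le_of_mul_le_mul_right this hR2
  have h6 : |κ'| * (48 * V1 + 1) < 6 * R * V1 := by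
    have : 6 * R * V1 = |κ'| * (48 * V1 + 1) + 6 * V1 := by
      rw [hR]
      field_simp
    rw [this]
    linarith
  linarith

end Targets

end Summit.NavierStokesRegularity.NavierStokesRegularity.Theorems.MustSqueeze.Negative

end
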